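import Summits.ABC.ABC.Theorems.DefiniteXiFreyModularityCMCorner
import Summits.ABC.ABC.Theorems.DefiniteXiFreyModularityStubAbsIrrNegThree
import Literature.NumberTheory.Automorphic.CDTTheorem722
import Literature.NumberTheory.EllipticCurves.CongruentNumberCurveIsModular
import HarnessLib

/-!
# Stub-ideation k = 3, GENERATION 18 (home family 3 = PROBE THE EXTREMES) for `stub_liftThree`
# of crux `FreyModularity` (stmt-ABC-11340, route ABC/DefiniteXi, `Lines/Sketch.lean`, sha 21576c53)
# — THE EXTREME INSTANCE IS ALREADY IN THE TREE: a complete, fact-free, non-vacuous inhabitant of the stub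

Companion of `STUB-IDEAS-stub_liftThree-3.md` (gen 18).  Nothing here is registered; the skeleton is
untouched.  NO `sorry`, NO named fact: every `theorem` below is PROVED from LANDED tree theorems
(`isModular_freyCurve_one_one` / `isModular_freyCurve_of_natAbs_eq_two` / `isModular_modThree_freyCurve_one_one`,
Theorems/DefiniteXiFreyModularityCMCorner, p157800/p158094, 2026-08-17;
`isAbsIrreducibleOverSqrt_negThree_freyCurve_of_not_three_dvd`, Theorems/…StubAbsIrrNegThree;
`not_nine_dvd_conductorNorm_freyCurve`, Theorems/…CDT; `BCDT.IsModular.isModularGaloisRepTate` = BCDT (2) ⇒ (4),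
Literature/…/CDTTheorem722 L281; `WeierstrassCurve.exists_isTorsionGaloisRep`, BCDTModularity L339).

Family-3 finding of gen 18 (autopsy of gen 17 + "the extreme instance"): gen 17 proposed six helper lemmas
H1–H6 (Deuring ψ → Hecke theta → Shimura newform → any-level (2) ⇒ (4)) to obtain "the first in-tree
inhabitant of the stub's conclusion type `IsModularGaloisRepTate`" on the maximal-CM corner.  For every STUB
purpose that inhabitant is two lines away from theorems landed on 2026-08-17: the Frey CM corner
`E_(a,b)`, `|ab(a+b)| = 2` (all `≅ 32a2 : y² = x³ − x`) is `BCDT.IsModular` unconditionally (explicit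
newform `η(4z)²η(8z)²`), and (2) ⇒ (4) is proved.  Moreover at `E_(1,1)` ALL FOUR hypotheses of the stub are
provably inhabited in the tree (`hρ` exists, `hirr` by the landed order-8 certificate since `3 ∤ 1·1·2`,
`h9` since `N = 32`, `hmod` by the landed residual modularity), so the stub is certified NON-VACUOUS and TRUE
at an honest instance — the degenerate-witness audit of S1b closed by an inhabitant, fact-free.
-/

set_option linter.dupNamespace false
set_option autoImplicit false

noncomputable section

open WeierstrassCurve
open Literature.NumberTheory.Automorphic Literature.NumberTheory.Automorphic.BCDT
open Literature.NumberTheory.GaloisRepresentations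
open Literature.NumberTheory.EllipticCurves Literature.NumberTheory.EllipticCurves.ModularForms
open Literature.NumberTheory.EllipticCurves.Tunnell1983
open Summit.ABC.ABC.Theorems

namespace Summit.ABC.ABC.Cruxes.FreyModularity.StubIdeas.LiftThree3g18

/-! ## §0 The registered stub (verbatim) -/

/-- The registered stub `stub_liftThree`, verbatim (`Lines/Sketch.lean` L157). [cite: Diamond1996, Thm. 5.4] -/
def SigStubLiftThree : Prop :=
  ∀ (W : WeierstrassCurve ℚ) [W.IsElliptic] (ρ : ModPGaloisRep ℚ (ZMod 3) 2),
    W.IsTorsionGaloisRep 3 ρ → ρ.IsAbsIrreducibleOverSqrt (-3) → ¬ 9 ∣ W.conductorNorm ℤ →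
    ρ.IsModular → W.IsModularGaloisRepTate 3

/-! ## §1 HL1 — pointwise, the stub is BCDT (2) for the curve (hypotheses unused) -/

/-- **HL1.** For every elliptic `W/ℚ` already known `BCDT.IsModular`, the stub's conclusion holds at every
prime `ℓ` — in particular at `ℓ = 3` with the four hypotheses unused.  (= `IsModular.isModularGaloisRepTate`.)
[cite: BCDTJAMS2001, Introduction ((2) ⇒ (4))] -/
theorem stubLiftThree_pointwise_of_isModular (W : WeierstrassCurve ℚ) [W.IsElliptic]
    [NeZero (W.conductorNorm ℤ)] (hW : BCDT.IsModular W) (ρ : ModPGaloisRep ℚ (ZMod 3) 2)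
    (_hρ : W.IsTorsionGaloisRep 3 ρ) (_hirr : ρ.IsAbsIrreducibleOverSqrt (-3))
    (_h9 : ¬ 9 ∣ W.conductorNorm ℤ) (_hmod : ρ.IsModular) : W.IsModularGaloisRepTate 3 :=
  hW.isModularGaloisRepTate 3

/-! ## §2 HL0 — the Frey CM corner satisfies BCDT (4) at EVERY prime, now -/

/-- **HL0.** Every Frey curve of the CM corner (`|ab(a+b)| = 2`, i.e. the six models of `32a2`) satisfies
`IsModularGaloisRepTate ℓ` for every prime `ℓ`, unconditionally. [cite: BCDTJAMS2001, Introduction ((2) ⇒ (4))]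
[cite: Tunnell1983Congruent, p. 325] -/
theorem isModularGaloisRepTate_freyCurve_of_natAbs_eq_two {a b : ℤ}
    (h2 : (a * b * (a + b)).natAbs = 2) (ℓ : ℕ) [Fact ℓ.Prime] :
    (freyCurve a b).IsModularGaloisRepTate ℓ := by
  have h0 : a * b * (a + b) ≠ 0 := by
    intro h; rw [h] at h2; simp at h2
  haveI := isElliptic_freyCurve h0
  haveI : NeZero ((freyCurve a b).conductorNorm ℤ) := ⟨(conductorNorm_pos_holds _).ne'⟩
  exact (isModular_freyCurve_of_natAbs_eq_two h2).isModularGaloisRepTate ℓ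

/-- **HL0′ (Literature-side twin).** The congruent number curve `E₁ : y² = x³ − x` satisfies BCDT (4) at every
prime. [cite: BCDTJAMS2001, Introduction ((2) ⇒ (4))] [cite: Tunnell1983Congruent, p. 325] -/
theorem isModularGaloisRepTate_congruentNumberCurve_one (ℓ : ℕ) [Fact ℓ.Prime] :
    (congruentNumberCurve 1).IsModularGaloisRepTate ℓ := by
  haveI := isElliptic_congruentNumberCurve_one
  haveI : NeZero ((congruentNumberCurve 1).conductorNorm ℤ) := ⟨(conductorNorm_pos_holds _).ne'⟩
  exact isModular_congruentNumberCurve_one.isModularGaloisRepTate ℓ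

/-! ## §3 The stub on the Frey CM corner, PROVED (four hypotheses unused) -/

/-- The stub restricted to the Frey CM corner. [cite: Diamond1996, Thm. 5.4] -/
def SigStubLiftThreeFreyCorner : Prop :=
  ∀ (W : WeierstrassCurve ℚ) [W.IsElliptic] (ρ : ModPGaloisRep ℚ (ZMod 3) 2),
    (∃ a b : ℤ, (a * b * (a + b)).natAbs = 2 ∧ W = freyCurve a b) →
    W.IsTorsionGaloisRep 3 ρ → ρ.IsAbsIrreducibleOverSqrt (-3) → ¬ 9 ∣ W.conductorNorm ℤ →
    ρ.IsModular → W.IsModularGaloisRepTate 3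

/-- ★ **The Frey CM corner of `stub_liftThree` holds NOW, fact-free.** [cite: Diamond1996, Thm. 5.4] -/
theorem sigStubLiftThreeFreyCorner_holds : SigStubLiftThreeFreyCorner := by
  rintro W _ ρ ⟨a, b, h2, rfl⟩ _ _ _ _
  exact isModularGaloisRepTate_freyCurve_of_natAbs_eq_two h2 3

/-- (sanity) the corner is the stub plus one hypothesis. [folklore] -/
theorem sigStubLiftThreeFreyCorner_of_stub (h : SigStubLiftThree) : SigStubLiftThreeFreyCorner :=
  fun W _ ρ _ hρ hirr h9 hmod ↦ h W ρ hρ hirr h9 hmod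

/-! ## §4 NON-VACUITY: at `E_(1,1)` all four hypotheses are inhabited AND the conclusion holds -/

/-- **NV.** The hypothesis set of `stub_liftThree` is jointly satisfiable in the tree, at an instance where the
conclusion is also a theorem: for `E_(1,1) : y² = x³ − x` (`N = 32`) there is a framed `ρ̄ = E[3]`
(`exists_isTorsionGaloisRep`); it is absolutely irreducible over `ℚ(√-3)` (good supersingular at `3`, inertia
image cyclic of order `8`: the landed `isAbsIrreducibleOverSqrt_negThree_freyCurve_of_not_three_dvd`, as
`3 ∤ 1·1·2`); `9 ∤ 32`; `ρ̄` is modular (`isModular_modThree_freyCurve_one_one`); and `E_(1,1)` satisfies (4)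
at `3`.  [cite: Serre1972, §1.11 Prop. 12 c)] [cite: Tunnell1983Congruent, p. 325] -/
theorem stubLiftThree_nonvacuous_freyCurve_one_one :
    haveI := isElliptic_freyCurve (a := 1) (b := 1) (by norm_num)
    ∃ ρ : ModPGaloisRep ℚ (ZMod 3) 2,
      (freyCurve 1 1).IsTorsionGaloisRep 3 ρ ∧ ρ.IsAbsIrreducibleOverSqrt (-3) ∧
      ¬ 9 ∣ (freyCurve 1 1).conductorNorm ℤ ∧ ρ.IsModular ∧ (freyCurve 1 1).IsModularGaloisRepTate 3 := by
  haveI := isElliptic_freyCurve (a := 1) (b := 1) (by norm_num)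
  obtain ⟨ρ, hρ⟩ := (freyCurve 1 1).exists_isTorsionGaloisRep 3
  refine ⟨ρ, hρ, ?_, ?_, isModular_modThree_freyCurve_one_one hρ,
    isModularGaloisRepTate_freyCurve_of_natAbs_eq_two (a := 1) (b := 1) (by norm_num) 3⟩
  · exact isAbsIrreducibleOverSqrt_negThree_freyCurve_of_not_three_dvd 1 1 isCoprime_one_left
      (by norm_num) (by norm_num) ρ hρ
  · rw [conductorNorm_freyCurve_one_one]; norm_num

/-! ## §5 Pins: the landed inputs (elaboration = they exist with these names) -/

example := @isModular_freyCurve_one_one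
example := @isModular_freyCurve_of_natAbs_eq_two
example := @isModular_modThree_freyCurve_one_one
example := @isAbsIrreducibleOverSqrt_negThree_freyCurve_of_not_three_dvd
example := @not_nine_dvd_conductorNorm_freyCurve
example := @IsModular.isModularGaloisRepTate
example := @isModular_congruentNumberCurve_one

end Summit.ABC.ABC.Cruxes.FreyModularity.StubIdeas.LiftThree3g18

end
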